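import Summits.BirchSwinnertonDyer.Rank1Residual.GaloisImage.KuriharaRecordBSDpThreeLevelTwoEndNoRank
import Summits.BirchSwinnertonDyer.Rank1Residual.Additive.X4ThreeKuriharaCertRecordsS2_23
import Summits.BirchSwinnertonDyer.Rank1Residual.Additive.X4ThreeKolyvaginLevelTwoCertificates1
import Summits.BirchSwinnertonDyer.Rank1Residual.Additive.JValuationOfIntModel
import Summits.BirchSwinnertonDyer.Rank1Residual.Additive.X4ThreeKuriharaCertRecordsS2_25
import HarnessLib

/-!
# END-m2 ROW SHAPES, file 2: `17190k1` + `17640ce1` — `BSD(E,3)` record shapes with the LEVEL SLOT OPEN (every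
# curve-side input discharged in the kernel; level, certificate and values left as binders)
# (cell `b2b-bsdres`, team n1011, ROUTE-1 §35.6 / §36 R1-61; companions of n1011-p18's per-(row, n)
# END-m2 records `Additive/X4ThreeKuriharaEndM2Record<label>.lean`; seat p03)

HONEST FRAMING (cell `b2b-bsdres`, run/shared/lean/b2b/bsd-rank1-residual/, verbatim in every
file): the goal of the cell is to DELETE the COMBINATION-SHAPED residual classes of the
Birch–Swinnerton-Dyer formula for ALL analytic-rank `≤ 1` elliptic curves over `ℚ` — "full BSD
formula for every rank `≤ 1` curve in class `C`" assembled STRICTLY from published theorems — so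
that the rank-`≤ 1` remainder becomes exactly the CONSTRUCTION-SHAPED classes, which are TYPED
(missing-input `Prop`s), NOT attempted. This is not "finishing BSD". Team n1011 (N10/N11, the
additive block `X4 ∧ p = 3`): research route; no claim beyond the stated classes; the label X4 and
the mark of RESIDUAL-MAP §I N11 are UNCHANGED by this file; nothing is booked.  These are PER-ROW
SHAPES (theorems only; no definition, no named fact minted) that CLOSE NOTHING: NO level is
instantiated and NO Kurihara value enters as a theorem input here — the level (`n ∈ 𝒩₃(E,3)`,
cyclicity) and the three values (`3·δ̃_n ≠ 0`, `3·δ̃_1 = 0` in `ℤ/9`, `δ̃_1 ≠ 0` in `ℤ/27`) stay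
BINDERS — in the lead's words (R5-74 (d)): 'SHAPE — closes nothing; level slot open; values enter
only through p18's per-(row, n) records on a two-source unit'; those records (n1011-p18, filed ONLY on
a two-source UNIT at that pair with the census register word, R5-68 (i) / R5-73 ADD 1) CONSUME these
row shapes BY NAME instead of restating the curve-side discharges.  Two files `{1,2}` because one
file of eight such theorems exceeds the 400-line cap (R5-74 (d) 'only if lint.size forces it').  CONDITIONAL inputs left as
binders: the UPPER-half named facts of the X4 chain of record (`hKatoS hDel hmodD hKatoχ`, with
`hGZK hmod h26`), Cassels–Tate (`hCT`), the Poitou–Tate family at `3` (or `hPT`), Tate's `hEP`, the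
ONE port `KatoKuriharaPortThreeAt W 1 v₃` (FLAG `K22-Thm3.13-PORT@3`, construction-shaped, NOT in
print at `3`), the optimal datum (`D`, `hopt`).  NO [S24] fact; NO `hr`.

## What this file does

Rows (both potentially MULTIPLICATIVE at `3`, class A2 = `#E(ℚ₃)[3] = 3`, register LOWER(M)):
* `17190k1` (`N = 17190 = 2·3²·5·191`; model `[1, -1, 0, 97843986, -294942486060]`; (M): `ord₃ j = -5`; `∏ c_ℓ = 4`; `#T = 1`; `#Ш_an = 9`; tower `towerSurj3_v17190k1`; `LocalTorsion3.natCard_threeTorsion_17190k1`);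
  §35.6 levels with an engine-2 UNIT (j136181, single engine, PROVISIONAL): `438751 = 541·811` (δ̃ ≡ 17 mod 27), `789319 = 541·1459` (δ̃ ≡ 26 mod 27), `1183249 = 811·1459` (δ̃ ≡ 8 mod 27).
* `17640ce1` (`N = 17640 = 2³·3²·5·7²`; model `[0, 0, 0, -1242003, -532681058]`; (M): `ord₃ j = -5`; `∏ c_ℓ = 8`; `#T = 2`; `#Ш_an = 9`; tower `towerSurj3_v17640ce1`; `natCard_threeTorsion_v17640ce1`);
  §35.6 levels with an engine-2 UNIT (j136181, single engine, PROVISIONAL): `1910197 = 163·11719` (δ̃ ≡ 10 mod 27);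
  zeros: 163·4159 = 677917 (engine 2: δ̃ ≡ 9 (mod 27) — a zero, never evidence); the PILOT level 163·1567 = 255421 is n1011-p18's `Additive/X4ThreeKuriharaEndM2Record17640ce1.lean` (not restated here).
For each row: **`bsdp3_endm2_v<L>_of_level`** — n1011-p18's END-m2 record corollary
`Assembly.bsdp_three_potMult_of_levelTwoCertificates_of_baseRigidity_noRank` (p299443) with EVERY
ROW input discharged BY NAME in the kernel (`3 ∣ Δ`, `3 ∣ c₄` by `decide`; the tower; `ord₃ j < 0` by
`padicValRat_j_neg_of_intModel hI 3 2` — `3³ ∤ c₄`, `3⁷ ∣ Δ`; `3 ∤ c₃` from `tamagawaProduct_v<L>`;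
`#E(ℚ₃)[3] = 3 ^ 1`; `N ≤ 130000`), binders left = facts + `hCT` + PT family + `hEP` + port + datum +
(`n`, `hn`, `hcyc`) + VALUES `hδ`; **`bsdp3_endm2_v<L>_of_level_of_facts`** — the same over
`…_of_facts_noRank` (`hPT`).  A record at a certified level `n` is then the one-liner
`bsdp3_endm2_v<L>_of_level … n (isKolyvaginProduct_three_v<L>_n<n> hI) (forall_card_torsion_le_v<L>_n<n> hI) hδ`.
Nothing booked; no port / fact discharged; X4 CONSTRUCTION-SHAPED; N11's mark unchanged.

References: C.-H. Kim, AJM 148 (2026) Thm. 1.9 (6), Thm. 3.13, §1.2.2 [Kim2022StructureSelmer];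
R. Sakamoto, JTNB 36 (2024) §2, Cor. 5.5 [Sakamoto2024]; K. Rubin, PCMI 18 (2011) Thm. 2.8.4,
Cor. 2.8.9 [Rubin2011]; J. S. Milne, ADT (2006) I.4.10 [MilneADT2006]; J. E. Cremona, *Algorithms
for Modular Elliptic Curves* (1997), Table 1 [CremonaAlgorithms1997]; J. H. Silverman, AEC (2009)
III.2.3, VII.5, X.4.14 [SilvermanAEC2009]; cell files cells/n1011/ROUTE-1.md §35.6/§36,
`b2b-bsdres-n1011-p03/g7/endm2-prep/ENDM2-LEVELS-KERNEL.tsv`, `b2b-bsdres-n1011-p08/e2at3/out/j136181/`.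
-/

set_option autoImplicit false

noncomputable section

open scoped Classical NumberField

open WeierstrassCurve Literature.NumberTheory.EllipticCurves Literature.NumberTheory.EllipticCurves.ModularForms
  Literature.NumberTheory.EllipticCurves.Rank1Residual
  Literature.NumberTheory.EllipticCurves.AgasheRibetStein2006
  Literature.NumberTheory.GaloisRepresentations Literature.NumberTheory.GaloisCohomology
  NumberField IsDedekindDomain
  Summit.BirchSwinnertonDyer.BirchSwinnertonDyer.Rank1Residual.IntModel
  Summit.BirchSwinnertonDyer.Rank1Residual.GaloisImage
  Summit.BirchSwinnertonDyer.Rank1Residual.X4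

namespace Summit.BirchSwinnertonDyer.Rank1Residual.Additive.X4ThreeKuriharaCert

/-! ### Row `17190k1` (`N = 17190`) — level slot open -/

/-- **END-m2 RECORD SHAPE for `17190k1`, LEVEL SLOT OPEN, [S24]-FREE base-rigidity form (the Poitou–Tate family at `3` as four binders) (CLOSES NOTHING, moves no
mark).**  For any globally minimal elliptic `W/ℚ` with integral model `[1, -1, 0, 97843986, -294942486060]`: the
row's kernel theorems — `3 ∣ Δ`, `3 ∣ c₄` (additive), the `3`-adic tower (`towerSurj3_v17190k1`),
`ord₃ j < 0` (`padicValRat_j_neg_of_intModel`, certificate `a = 2`: `3³ ∤ c₄`, `3⁷ ∣ Δ`), `3 ∤ c₃`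
(`tamagawaProduct_v17190k1 = 4`), `#E(ℚ₃)[3] = 3 ^ 1` (`LocalTorsion3.natCard_threeTorsion_17190k1`),
`N = 17190 ≤ 130000` — feed `Assembly.bsdp_three_potMult_of_levelTwoCertificates_of_baseRigidity_noRank`;
HYPOTHESES left: the UPPER named facts, `hCT`, the Poitou–Tate family, `hEP`, ONE
`hPort : KatoKuriharaPortThreeAt W 1 v₃`, the optimal datum `D`/`hopt`, the LEVEL (`n ∈ 𝒩₃(E,3)` as
`hn`, cyclicity `hcyc`) and the three Kurihara VALUES `hδ` (EVIDENCE when instantiated): `3·δ̃_n(ψ) ≠ 0`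
and `3·δ̃_1 = 0` in `ℤ/9`, `δ̃_1 ≠ 0` in `ℤ/27`.  NO [S24] fact, NO `hr`.  SHAPE — closes nothing; level
slot open; values enter only through p18's per-(row, n) records on a two-source unit (lead R5-74 (d)).
[cite: Kim2022StructureSelmer, Thm. 1.9 (6) and Thm. 3.13] [cite: Rubin2011, Thm. 2.8.4 and Cor. 2.8.9]
[cite: CremonaAlgorithms1997, Table 1 (Cremona label 17190k1)] -/
theorem bsdp3_endm2_v17190k1_of_level
    (hKatoS : Kato2004.rankZero_padicValNat_sha_le_sub_localTamagawa_of_additive_potGood_of_imageContainsSL2)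
    (hDel : Delbourgo1998.prop4_rankZero_pow_dvd_constantCoeff)
    (hGZK : rank_eq_analyticRank_of_analyticRank_le_one) (hmod : hasEntireLFunction_rat)
    (hmodD : nonempty_modularParametrizationData)
    (hKatoχ : Wuthrich2014.kato_halfEigenCharIdeal_dvd_cyclotomicPrime_of_surjective)
    (h26 : cremona_abs_maninConstant_eq_one_of_level_le)
    (hCT : exists_casselsTate_pairing (K := ℚ))
    {W : WeierstrassCurve ℚ} [W.IsElliptic] [W.IsGloballyMinimal]
    (hI : integralModelInt W = ⟨1, -1, 0, 97843986, -294942486060⟩)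
    (D : ModularParametrizationData W 17190)
    (hopt : ∀ z ∈ D.L.lattice, ∃ w ∈ periodLattice D.f, z = D.c * w)
    (inv : LocalInvariants ℚ 3) (hperf : inv.IsPerfect) (hsum : inv.SumLocalTermEqZero)
    (hcompl : inv.SelmerComplement)
    (hEP : ∀ v : HeightOneSpectrum (𝓞 ℚ), localEulerPoincareCharacteristic (v.adicCompletion ℚ))
    (v₃ : HeightOneSpectrum (𝓞 ℚ)) (hv₃ : ((3 : ℕ) : 𝓞 ℚ) ∈ v₃.asIdeal)
    (hPort : KatoKuriharaPortThreeAt W 1 v₃)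
    (n : ℕ) [NeZero n] (hn : haveI : Fact (Nat.Prime 3) := ⟨Nat.prime_three⟩; Kato.IsKolyvaginProduct W 3 3 n)
    (hcyc : ∀ (ℓ : ℕ) [Fact ℓ.Prime], ℓ ∣ n →
      Nat.card {P : ((WeierstrassCurve.integralModelInt W).map
          (Int.castRingHom (ZMod ℓ))).toAffine.Point // 3 • P = 0} ≤ 3)
    (hδ : ∃ (ψ : (ℓ : ℕ) → (ZMod ℓ)ˣ →* Multiplicative (ZMod (3 ^ 2)))
        (ψ₂₇ : (ℓ : ℕ) → (ZMod ℓ)ˣ →* Multiplicative (ZMod (3 ^ 3))),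
      (∀ ℓ ∈ (n : ℕ).primeFactors, Function.Surjective (ψ ℓ)) ∧
        (3 : ZMod (3 ^ 2)) * kuriharaNumber D.f (3 ^ 2) n ψ ≠ 0 ∧
        (3 : ZMod (3 ^ 2)) * kuriharaNumber D.f (3 ^ 2) 1 ψ = 0 ∧
        kuriharaNumber D.f (3 ^ 3) 1 ψ₂₇ ≠ 0) :
    haveI : Fact (Nat.Prime 3) := ⟨Nat.prime_three⟩
    BSDp W 3 := by
  haveI : Fact (Nat.Prime 3) := ⟨Nat.prime_three⟩
  obtain ⟨ψ, ψ₂₇, hψ, hcert, hzero₉, hunit₁⟩ := hδ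
  have htam : ¬ 3 ∣ W.tamagawaProduct := by rw [tamagawaProduct_v17190k1 hI]; decide
  have hc3 : ¬ 3 ∣ (W.baseChange ℚ_[3]).localTamagawaNumber ℤ_[3] := fun h =>
    htam (h.trans (localTamagawaNumber_padic_dvd_tamagawaProduct W 3))
  have hjneg : padicValRat 3 W.j < 0 :=
    padicValRat_j_neg_of_intModel hI 3 2 (by decide +kernel) (by decide +kernel)
  exact Assembly.bsdp_three_potMult_of_levelTwoCertificates_of_baseRigidity_noRank hKatoS hDel hGZK
    hmod hmodD hKatoχ h26 hCT W hI (by decide +kernel) (by decide +kernel) (towerSurj3_v17190k1 hI)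
    hjneg hc3 (LocalTorsion3.natCard_threeTorsion_17190k1 W hI) (by norm_num) D hopt inv hperf hsum hcompl hEP v₃
    hv₃ hPort n hn hcyc ψ hψ hcert hzero₉ ψ₂₇ hunit₁

/-- **END-m2 RECORD SHAPE for `17190k1`, LEVEL SLOT OPEN, NAMED-FACTS form (the Poitou–Tate family replaced by `hPT : poitouTate_selmerStructure_duality ℚ`) (CLOSES NOTHING, moves no
mark).**  For any globally minimal elliptic `W/ℚ` with integral model `[1, -1, 0, 97843986, -294942486060]`: the
row's kernel theorems — `3 ∣ Δ`, `3 ∣ c₄` (additive), the `3`-adic tower (`towerSurj3_v17190k1`),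
`ord₃ j < 0` (`padicValRat_j_neg_of_intModel`, certificate `a = 2`: `3³ ∤ c₄`, `3⁷ ∣ Δ`), `3 ∤ c₃`
(`tamagawaProduct_v17190k1 = 4`), `#E(ℚ₃)[3] = 3 ^ 1` (`LocalTorsion3.natCard_threeTorsion_17190k1`),
`N = 17190 ≤ 130000` — feed `Assembly.bsdp_three_potMult_of_levelTwoCertificates_of_facts_noRank`;
HYPOTHESES left: the UPPER named facts, `hCT`, `hPT`, `hEP`, ONE
`hPort : KatoKuriharaPortThreeAt W 1 v₃`, the optimal datum `D`/`hopt`, the LEVEL (`n ∈ 𝒩₃(E,3)` as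
`hn`, cyclicity `hcyc`) and the three Kurihara VALUES `hδ` (EVIDENCE when instantiated): `3·δ̃_n(ψ) ≠ 0`
and `3·δ̃_1 = 0` in `ℤ/9`, `δ̃_1 ≠ 0` in `ℤ/27`.  NO [S24] fact, NO `hr`.  SHAPE — closes nothing; level
slot open; values enter only through p18's per-(row, n) records on a two-source unit (lead R5-74 (d)).
[cite: Kim2022StructureSelmer, Thm. 1.9 (6) and Thm. 3.13] [cite: MilneADT2006, Ch. I, Thm. 4.10]
[cite: CremonaAlgorithms1997, Table 1 (Cremona label 17190k1)] -/
theorem bsdp3_endm2_v17190k1_of_level_of_facts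
    (hKatoS : Kato2004.rankZero_padicValNat_sha_le_sub_localTamagawa_of_additive_potGood_of_imageContainsSL2)
    (hDel : Delbourgo1998.prop4_rankZero_pow_dvd_constantCoeff)
    (hGZK : rank_eq_analyticRank_of_analyticRank_le_one) (hmod : hasEntireLFunction_rat)
    (hmodD : nonempty_modularParametrizationData)
    (hKatoχ : Wuthrich2014.kato_halfEigenCharIdeal_dvd_cyclotomicPrime_of_surjective)
    (h26 : cremona_abs_maninConstant_eq_one_of_level_le)
    (hCT : exists_casselsTate_pairing (K := ℚ))
    (hPT : poitouTate_selmerStructure_duality ℚ)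
    {W : WeierstrassCurve ℚ} [W.IsElliptic] [W.IsGloballyMinimal]
    (hI : integralModelInt W = ⟨1, -1, 0, 97843986, -294942486060⟩)
    (D : ModularParametrizationData W 17190)
    (hopt : ∀ z ∈ D.L.lattice, ∃ w ∈ periodLattice D.f, z = D.c * w)
    (hEP : ∀ v : HeightOneSpectrum (𝓞 ℚ), localEulerPoincareCharacteristic (v.adicCompletion ℚ))
    (v₃ : HeightOneSpectrum (𝓞 ℚ)) (hv₃ : ((3 : ℕ) : 𝓞 ℚ) ∈ v₃.asIdeal)
    (hPort : KatoKuriharaPortThreeAt W 1 v₃)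
    (n : ℕ) [NeZero n] (hn : haveI : Fact (Nat.Prime 3) := ⟨Nat.prime_three⟩; Kato.IsKolyvaginProduct W 3 3 n)
    (hcyc : ∀ (ℓ : ℕ) [Fact ℓ.Prime], ℓ ∣ n →
      Nat.card {P : ((WeierstrassCurve.integralModelInt W).map
          (Int.castRingHom (ZMod ℓ))).toAffine.Point // 3 • P = 0} ≤ 3)
    (hδ : ∃ (ψ : (ℓ : ℕ) → (ZMod ℓ)ˣ →* Multiplicative (ZMod (3 ^ 2)))
        (ψ₂₇ : (ℓ : ℕ) → (ZMod ℓ)ˣ →* Multiplicative (ZMod (3 ^ 3))),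
      (∀ ℓ ∈ (n : ℕ).primeFactors, Function.Surjective (ψ ℓ)) ∧
        (3 : ZMod (3 ^ 2)) * kuriharaNumber D.f (3 ^ 2) n ψ ≠ 0 ∧
        (3 : ZMod (3 ^ 2)) * kuriharaNumber D.f (3 ^ 2) 1 ψ = 0 ∧
        kuriharaNumber D.f (3 ^ 3) 1 ψ₂₇ ≠ 0) :
    haveI : Fact (Nat.Prime 3) := ⟨Nat.prime_three⟩
    BSDp W 3 := by
  haveI : Fact (Nat.Prime 3) := ⟨Nat.prime_three⟩
  obtain ⟨ψ, ψ₂₇, hψ, hcert, hzero₉, hunit₁⟩ := hδ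
  have htam : ¬ 3 ∣ W.tamagawaProduct := by rw [tamagawaProduct_v17190k1 hI]; decide
  have hc3 : ¬ 3 ∣ (W.baseChange ℚ_[3]).localTamagawaNumber ℤ_[3] := fun h =>
    htam (h.trans (localTamagawaNumber_padic_dvd_tamagawaProduct W 3))
  have hjneg : padicValRat 3 W.j < 0 :=
    padicValRat_j_neg_of_intModel hI 3 2 (by decide +kernel) (by decide +kernel)
  exact Assembly.bsdp_three_potMult_of_levelTwoCertificates_of_facts_noRank hKatoS hDel hGZK
    hmod hmodD hKatoχ h26 hCT W hI (by decide +kernel) (by decide +kernel) (towerSurj3_v17190k1 hI)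
    hjneg hc3 (LocalTorsion3.natCard_threeTorsion_17190k1 W hI) (by norm_num) D hopt hPT hEP v₃
    hv₃ hPort n hn hcyc ψ hψ hcert hzero₉ ψ₂₇ hunit₁

/-! ### Row `17640ce1` (`N = 17640`) — level slot open -/

/-- **END-m2 RECORD SHAPE for `17640ce1`, LEVEL SLOT OPEN, [S24]-FREE base-rigidity form (the Poitou–Tate family at `3` as four binders) (CLOSES NOTHING, moves no
mark).**  For any globally minimal elliptic `W/ℚ` with integral model `[0, 0, 0, -1242003, -532681058]`: the
row's kernel theorems — `3 ∣ Δ`, `3 ∣ c₄` (additive), the `3`-adic tower (`towerSurj3_v17640ce1`),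
`ord₃ j < 0` (`padicValRat_j_neg_of_intModel`, certificate `a = 2`: `3³ ∤ c₄`, `3⁷ ∣ Δ`), `3 ∤ c₃`
(`tamagawaProduct_v17640ce1 = 8`), `#E(ℚ₃)[3] = 3 ^ 1` (`natCard_threeTorsion_v17640ce1`),
`N = 17640 ≤ 130000` — feed `Assembly.bsdp_three_potMult_of_levelTwoCertificates_of_baseRigidity_noRank`;
HYPOTHESES left: the UPPER named facts, `hCT`, the Poitou–Tate family, `hEP`, ONE
`hPort : KatoKuriharaPortThreeAt W 1 v₃`, the optimal datum `D`/`hopt`, the LEVEL (`n ∈ 𝒩₃(E,3)` as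
`hn`, cyclicity `hcyc`) and the three Kurihara VALUES `hδ` (EVIDENCE when instantiated): `3·δ̃_n(ψ) ≠ 0`
and `3·δ̃_1 = 0` in `ℤ/9`, `δ̃_1 ≠ 0` in `ℤ/27`.  NO [S24] fact, NO `hr`.  SHAPE — closes nothing; level
slot open; values enter only through p18's per-(row, n) records on a two-source unit (lead R5-74 (d)).
[cite: Kim2022StructureSelmer, Thm. 1.9 (6) and Thm. 3.13] [cite: Rubin2011, Thm. 2.8.4 and Cor. 2.8.9]
[cite: CremonaAlgorithms1997, Table 1 (Cremona label 17640ce1)] -/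
theorem bsdp3_endm2_v17640ce1_of_level
    (hKatoS : Kato2004.rankZero_padicValNat_sha_le_sub_localTamagawa_of_additive_potGood_of_imageContainsSL2)
    (hDel : Delbourgo1998.prop4_rankZero_pow_dvd_constantCoeff)
    (hGZK : rank_eq_analyticRank_of_analyticRank_le_one) (hmod : hasEntireLFunction_rat)
    (hmodD : nonempty_modularParametrizationData)
    (hKatoχ : Wuthrich2014.kato_halfEigenCharIdeal_dvd_cyclotomicPrime_of_surjective)
    (h26 : cremona_abs_maninConstant_eq_one_of_level_le)
    (hCT : exists_casselsTate_pairing (K := ℚ))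
    {W : WeierstrassCurve ℚ} [W.IsElliptic] [W.IsGloballyMinimal]
    (hI : integralModelInt W = ⟨0, 0, 0, -1242003, -532681058⟩)
    (D : ModularParametrizationData W 17640)
    (hopt : ∀ z ∈ D.L.lattice, ∃ w ∈ periodLattice D.f, z = D.c * w)
    (inv : LocalInvariants ℚ 3) (hperf : inv.IsPerfect) (hsum : inv.SumLocalTermEqZero)
    (hcompl : inv.SelmerComplement)
    (hEP : ∀ v : HeightOneSpectrum (𝓞 ℚ), localEulerPoincareCharacteristic (v.adicCompletion ℚ))
    (v₃ : HeightOneSpectrum (𝓞 ℚ)) (hv₃ : ((3 : ℕ) : 𝓞 ℚ) ∈ v₃.asIdeal)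
    (hPort : KatoKuriharaPortThreeAt W 1 v₃)
    (n : ℕ) [NeZero n] (hn : haveI : Fact (Nat.Prime 3) := ⟨Nat.prime_three⟩; Kato.IsKolyvaginProduct W 3 3 n)
    (hcyc : ∀ (ℓ : ℕ) [Fact ℓ.Prime], ℓ ∣ n →
      Nat.card {P : ((WeierstrassCurve.integralModelInt W).map
          (Int.castRingHom (ZMod ℓ))).toAffine.Point // 3 • P = 0} ≤ 3)
    (hδ : ∃ (ψ : (ℓ : ℕ) → (ZMod ℓ)ˣ →* Multiplicative (ZMod (3 ^ 2)))
        (ψ₂₇ : (ℓ : ℕ) → (ZMod ℓ)ˣ →* Multiplicative (ZMod (3 ^ 3))),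
      (∀ ℓ ∈ (n : ℕ).primeFactors, Function.Surjective (ψ ℓ)) ∧
        (3 : ZMod (3 ^ 2)) * kuriharaNumber D.f (3 ^ 2) n ψ ≠ 0 ∧
        (3 : ZMod (3 ^ 2)) * kuriharaNumber D.f (3 ^ 2) 1 ψ = 0 ∧
        kuriharaNumber D.f (3 ^ 3) 1 ψ₂₇ ≠ 0) :
    haveI : Fact (Nat.Prime 3) := ⟨Nat.prime_three⟩
    BSDp W 3 := by
  haveI : Fact (Nat.Prime 3) := ⟨Nat.prime_three⟩
  obtain ⟨ψ, ψ₂₇, hψ, hcert, hzero₉, hunit₁⟩ := hδ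
  have htam : ¬ 3 ∣ W.tamagawaProduct := by rw [tamagawaProduct_v17640ce1 hI]; decide
  have hc3 : ¬ 3 ∣ (W.baseChange ℚ_[3]).localTamagawaNumber ℤ_[3] := fun h =>
    htam (h.trans (localTamagawaNumber_padic_dvd_tamagawaProduct W 3))
  have hjneg : padicValRat 3 W.j < 0 :=
    padicValRat_j_neg_of_intModel hI 3 2 (by decide +kernel) (by decide +kernel)
  exact Assembly.bsdp_three_potMult_of_levelTwoCertificates_of_baseRigidity_noRank hKatoS hDel hGZK
    hmod hmodD hKatoχ h26 hCT W hI (by decide +kernel) (by decide +kernel) (towerSurj3_v17640ce1 hI)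
    hjneg hc3 (natCard_threeTorsion_v17640ce1 W hI) (by norm_num) D hopt inv hperf hsum hcompl hEP v₃
    hv₃ hPort n hn hcyc ψ hψ hcert hzero₉ ψ₂₇ hunit₁

/-- **END-m2 RECORD SHAPE for `17640ce1`, LEVEL SLOT OPEN, NAMED-FACTS form (the Poitou–Tate family replaced by `hPT : poitouTate_selmerStructure_duality ℚ`) (CLOSES NOTHING, moves no
mark).**  For any globally minimal elliptic `W/ℚ` with integral model `[0, 0, 0, -1242003, -532681058]`: the
row's kernel theorems — `3 ∣ Δ`, `3 ∣ c₄` (additive), the `3`-adic tower (`towerSurj3_v17640ce1`),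
`ord₃ j < 0` (`padicValRat_j_neg_of_intModel`, certificate `a = 2`: `3³ ∤ c₄`, `3⁷ ∣ Δ`), `3 ∤ c₃`
(`tamagawaProduct_v17640ce1 = 8`), `#E(ℚ₃)[3] = 3 ^ 1` (`natCard_threeTorsion_v17640ce1`),
`N = 17640 ≤ 130000` — feed `Assembly.bsdp_three_potMult_of_levelTwoCertificates_of_facts_noRank`;
HYPOTHESES left: the UPPER named facts, `hCT`, `hPT`, `hEP`, ONE
`hPort : KatoKuriharaPortThreeAt W 1 v₃`, the optimal datum `D`/`hopt`, the LEVEL (`n ∈ 𝒩₃(E,3)` as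
`hn`, cyclicity `hcyc`) and the three Kurihara VALUES `hδ` (EVIDENCE when instantiated): `3·δ̃_n(ψ) ≠ 0`
and `3·δ̃_1 = 0` in `ℤ/9`, `δ̃_1 ≠ 0` in `ℤ/27`.  NO [S24] fact, NO `hr`.  SHAPE — closes nothing; level
slot open; values enter only through p18's per-(row, n) records on a two-source unit (lead R5-74 (d)).
[cite: Kim2022StructureSelmer, Thm. 1.9 (6) and Thm. 3.13] [cite: MilneADT2006, Ch. I, Thm. 4.10]
[cite: CremonaAlgorithms1997, Table 1 (Cremona label 17640ce1)] -/
theorem bsdp3_endm2_v17640ce1_of_level_of_facts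
    (hKatoS : Kato2004.rankZero_padicValNat_sha_le_sub_localTamagawa_of_additive_potGood_of_imageContainsSL2)
    (hDel : Delbourgo1998.prop4_rankZero_pow_dvd_constantCoeff)
    (hGZK : rank_eq_analyticRank_of_analyticRank_le_one) (hmod : hasEntireLFunction_rat)
    (hmodD : nonempty_modularParametrizationData)
    (hKatoχ : Wuthrich2014.kato_halfEigenCharIdeal_dvd_cyclotomicPrime_of_surjective)
    (h26 : cremona_abs_maninConstant_eq_one_of_level_le)
    (hCT : exists_casselsTate_pairing (K := ℚ))
    (hPT : poitouTate_selmerStructure_duality ℚ)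
    {W : WeierstrassCurve ℚ} [W.IsElliptic] [W.IsGloballyMinimal]
    (hI : integralModelInt W = ⟨0, 0, 0, -1242003, -532681058⟩)
    (D : ModularParametrizationData W 17640)
    (hopt : ∀ z ∈ D.L.lattice, ∃ w ∈ periodLattice D.f, z = D.c * w)
    (hEP : ∀ v : HeightOneSpectrum (𝓞 ℚ), localEulerPoincareCharacteristic (v.adicCompletion ℚ))
    (v₃ : HeightOneSpectrum (𝓞 ℚ)) (hv₃ : ((3 : ℕ) : 𝓞 ℚ) ∈ v₃.asIdeal)
    (hPort : KatoKuriharaPortThreeAt W 1 v₃)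
    (n : ℕ) [NeZero n] (hn : haveI : Fact (Nat.Prime 3) := ⟨Nat.prime_three⟩; Kato.IsKolyvaginProduct W 3 3 n)
    (hcyc : ∀ (ℓ : ℕ) [Fact ℓ.Prime], ℓ ∣ n →
      Nat.card {P : ((WeierstrassCurve.integralModelInt W).map
          (Int.castRingHom (ZMod ℓ))).toAffine.Point // 3 • P = 0} ≤ 3)
    (hδ : ∃ (ψ : (ℓ : ℕ) → (ZMod ℓ)ˣ →* Multiplicative (ZMod (3 ^ 2)))
        (ψ₂₇ : (ℓ : ℕ) → (ZMod ℓ)ˣ →* Multiplicative (ZMod (3 ^ 3))),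
      (∀ ℓ ∈ (n : ℕ).primeFactors, Function.Surjective (ψ ℓ)) ∧
        (3 : ZMod (3 ^ 2)) * kuriharaNumber D.f (3 ^ 2) n ψ ≠ 0 ∧
        (3 : ZMod (3 ^ 2)) * kuriharaNumber D.f (3 ^ 2) 1 ψ = 0 ∧
        kuriharaNumber D.f (3 ^ 3) 1 ψ₂₇ ≠ 0) :
    haveI : Fact (Nat.Prime 3) := ⟨Nat.prime_three⟩
    BSDp W 3 := by
  haveI : Fact (Nat.Prime 3) := ⟨Nat.prime_three⟩
  obtain ⟨ψ, ψ₂₇, hψ, hcert, hzero₉, hunit₁⟩ := hδ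
  have htam : ¬ 3 ∣ W.tamagawaProduct := by rw [tamagawaProduct_v17640ce1 hI]; decide
  have hc3 : ¬ 3 ∣ (W.baseChange ℚ_[3]).localTamagawaNumber ℤ_[3] := fun h =>
    htam (h.trans (localTamagawaNumber_padic_dvd_tamagawaProduct W 3))
  have hjneg : padicValRat 3 W.j < 0 :=
    padicValRat_j_neg_of_intModel hI 3 2 (by decide +kernel) (by decide +kernel)
  exact Assembly.bsdp_three_potMult_of_levelTwoCertificates_of_facts_noRank hKatoS hDel hGZK
    hmod hmodD hKatoχ h26 hCT W hI (by decide +kernel) (by decide +kernel) (towerSurj3_v17640ce1 hI)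
    hjneg hc3 (natCard_threeTorsion_v17640ce1 W hI) (by norm_num) D hopt hPT hEP v₃
    hv₃ hPort n hn hcyc ψ hψ hcert hzero₉ ψ₂₇ hunit₁

end Summit.BirchSwinnertonDyer.Rank1Residual.Additive.X4ThreeKuriharaCert

end
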